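import Mathlib

/-!
# `AbelianNoGo` — the combinatorial core (levels and the injectivity of `Ψ`)

Route `MatrixMultiplication/OrbitHarmonicsHosts`, support item `stmt-MatrixMultiplication-5456`
(`AbelianNoGo`).  This file isolates the purely combinatorial heart of the abelian no-go theorem.

Setting (written additively): `Λ` an additive commutative group (the character group of the finite
abelian symmetry group), a "level" function `ℓ : Λ → ℕ` (the degree in which a character sits in
the orbit-harmonics ring) and three weight families `p q r : Fin N → Λ` (the eigencharacters of
`ρ_P, ρ_Q, ρ_R`).  The hosting identity forces

* `hmatch`  (matched products are non-zero): `ℓ (r u - p s) = ℓ (q t - p s) + ℓ (r u - q t)`;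
* `hcross`  (cross products `t₁ ≠ t₂` whose weight is an output weight vanish, hence are *not*
  additive in level): `(q t₁ - p s₁) + (r u₂ - q t₂) = r u₁ - p s₂ → ℓ (r u₁ - p s₂) ≠ …`;
* `hC`      (output weights are distinct): `r u₁ - p s₁ = r u₂ - p s₂ → s₁ = s₂ ∧ u₁ = u₂`;

and `ℓ` is subadditive.  Conclusion: `Ψ (s,t,u) = q t - p s - r u` is injective, which bounds
`N³` by the number of characters.  The proof is the "two strict inequalities add up to `0 < 0`"
argument of the route rationale (Cohn–Umans style injectivity for abelian groups).
-/

-- single-conjunct summit: the mandated namespace repeats `MatrixMultiplication`.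
set_option linter.dupNamespace false

namespace Summit.MatrixMultiplication.MatrixMultiplication.Theorems

namespace AbelianNoGo

variable {Λ : Type*} [AddCommGroup Λ] {N : ℕ}

/-- **Combinatorial core of the abelian no-go.**  With a subadditive level function `ℓ`, matched
products additive in level (`hmatch`), colliding cross products non-additive (`hcross`) and
distinct output weights (`hC`), the map `(s,t,u) ↦ q t - p s - r u` is injective.  If
`Ψ (s₁,t₁,u₁) = Ψ (s₂,t₂,u₂)` with `t₁ ≠ t₂`, the two cross products `(s₁,t₁)×(t₂,u₂)` and
`(s₂,t₂)×(t₁,u₁)` have the output weights of `(s₂,u₁)` and `(s₁,u₂)`; subadditivity and `hcross`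
make both level inequalities strict, and adding them contradicts `hmatch`; if `t₁ = t₂` the
collision is one of output weights and `hC` applies. [folklore] -/
theorem psi_injective (ℓ : Λ → ℕ) (p q r : Fin N → Λ)
    (hsub : ∀ χ ψ : Λ, ℓ (χ + ψ) ≤ ℓ χ + ℓ ψ)
    (hmatch : ∀ s t u, ℓ (r u - p s) = ℓ (q t - p s) + ℓ (r u - q t))
    (hcross : ∀ s₁ t₁ u₁ s₂ t₂ u₂, t₁ ≠ t₂ → (q t₁ - p s₁) + (r u₂ - q t₂) = r u₁ - p s₂ →
        ℓ (r u₁ - p s₂) ≠ ℓ (q t₁ - p s₁) + ℓ (r u₂ - q t₂))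
    (hC : ∀ s₁ u₁ s₂ u₂, r u₁ - p s₁ = r u₂ - p s₂ → s₁ = s₂ ∧ u₁ = u₂) :
    Function.Injective (fun stu : Fin N × Fin N × Fin N => q stu.2.1 - p stu.1 - r stu.2.2) := by
  rintro ⟨s₁, t₁, u₁⟩ ⟨s₂, t₂, u₂⟩ h
  simp only at h
  by_cases ht : t₁ = t₂
  · subst ht
    have hc : r u₂ - p s₁ = r u₁ - p s₂ := by
      rw [← sub_eq_zero] at h ⊢
      rw [← h]
      abel
    obtain ⟨rfl, rfl⟩ := hC s₁ u₂ s₂ u₁ hc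
    rfl
  · exfalso
    have e1 : (q t₁ - p s₁) + (r u₂ - q t₂) = r u₁ - p s₂ := by
      rw [← sub_eq_zero] at h ⊢
      rw [← h]
      abel
    have e2 : (q t₂ - p s₂) + (r u₁ - q t₁) = r u₂ - p s₁ := by
      rw [← sub_eq_zero] at h ⊢
      rw [← neg_eq_zero, ← h]
      abel
    have n1 := hcross s₁ t₁ u₁ s₂ t₂ u₂ ht e1
    have n2 := hcross s₂ t₂ u₂ s₁ t₁ u₁ (Ne.symm ht) e2
    have l1 : ℓ (r u₁ - p s₂) < ℓ (q t₁ - p s₁) + ℓ (r u₂ - q t₂) :=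
      lt_of_le_of_ne (e1 ▸ hsub _ _) n1
    have l2 : ℓ (r u₂ - p s₁) < ℓ (q t₂ - p s₂) + ℓ (r u₁ - q t₁) :=
      lt_of_le_of_ne (e2 ▸ hsub _ _) n2
    have m11 := hmatch s₁ t₁ u₁
    have m22 := hmatch s₂ t₂ u₂
    have m21 := hmatch s₂ t₁ u₁
    have m12 := hmatch s₁ t₁ u₂
    have m11' := hmatch s₁ t₂ u₁
    have m22' := hmatch s₂ t₁ u₂
    omega

end AbelianNoGo

end Summit.MatrixMultiplication.MatrixMultiplication.Theorems
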